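import Summits.CriticalPhenomena.CardyFormulaZ2.Theorems.CardyIKTransportIKLinearTransportStubPinnedSamplerShape

/-!
# Stub `stub_PinnedSampler` — the DYNAMICAL SHAPE of the remaining theorem:
# an exact, coalescing, quasi-local row dynamics of the diagram-conditioned middle column

Support file (`--supports stmt-CriticalPhenomena-5076`, registered sub-goal `pinnedSampler_of_rowCFTP`).
Vocabulary of the coupling-from-the-past route to `stub_PinnedSampler` (statements the line POSITS,
parametrised; nothing cited):

* `rowSweep Φ n a p u z` — the sweep of a ROW-RESAMPLING DYNAMICS `Φ`: resample the middle data (cell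
  `(i+1, y)`, faces `(i, y)`, `(i+1, y)`) of the rows `y = a, a+1, …, a+n-1` of `z`, in increasing order, in
  the environment `p` (a value of the pinned statistic `pinnedStat i = (eraseMid i, stripDiagram i)`),
  reading the fresh bits `u`;
* `IsRowCFTP C c S i Φ Coal` — (A_dyn), the dynamical form of strong spatial mixing in mean: `Φ` is
  measurable, rewrites only the middle row it visits, is vertically covariant and EXACT (a sweep from
  `X' ∼ νmix (S ∆ {i,i+1})` with fresh bits has, jointly with the pinned statistic and on the events not
  reading the rows above the sweep, the law of `X'`: the row maps sample the conditional law of a middle row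
  of the exchanged model given the pinned statistic and the middle rows below it — the diagram-conditioned
  transfer-matrix chain); `Coal y m` are measurable, vertically covariant CERTIFIED COALESCENCE events
  (sound: on `Coal y m` the sweep of the rows `y-m, …, y` produces the same row-`y` middle bits from every
  start — the grand coupling has coalesced) failing with `νmix S ⊗ β`-probability `≤ C e^{-c m}`; and the
  depth-`r` sweeps agree, off an event of probability `≤ C e^{-c r}`, with `2r`-local rules on `ballInf v r`
  (forgetting of the environment: the backward messages of the conditioned chain are local in mean).

`pinnedSampler_of_rowCFTP` (sorry-free composition, registered): (A_dyn) with constants uniform in the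
admissible `(S, i)` + THE CODING STEP (B) — stated here as the hypothesis "`IsRowCFTP C c S i Φ Coal` and
`StripDiagramExchange S i` give a pinned sampler with constants depending on `C, c` only", which is exactly
the landed theorem `ps2_pinnedSampler_of_rowCFTP` (`…StubPinnedSamplerCFTP.lean`, constants
`(max C 0 · (2 + 4/c), c/2)`) read through this vocabulary — give the registered signature of
`stub_PinnedSampler` verbatim. What then remains of the stub is (A_dyn) alone:
`∃ C c, 0 < c ∧ ∀ S i, (i ∈ S ↔ i+1 ∉ S) → StripDiagramExchange S i → ∃ Φ Coal, IsRowCFTP C c S i Φ Coal`.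
-/

noncomputable section

namespace Summit.CriticalPhenomena.CardyFormulaZ2.Theorems.IKLinearTransport.PinnedDiagramExchange

open scoped Classical MeasureTheory ENNReal symmDiff
open Set MeasureTheory
open Literature.Probability.Percolation Literature.Probability.LatticeModels

/-- The SWEEP of the row dynamics `Φ`: resample the middle rows `a, …, a+n-1` of `z` upward, in the
environment `p`, with the bits `u`. [folklore] -/
def rowSweep (Φ : ℤ → Obs × Set (Site 2 × Site 2) → Rnd → Obs → Obs) (n : ℕ) (a : ℤ)
    (p : Obs × Set (Site 2 × Site 2)) (u : Rnd) (z : Obs) : Obs :=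
  ((fun q : ℤ × Obs => (q.1 + 1, Φ q.1 p u q.2))^[n] (a, z)).2

/-- (A_dyn) · `IsRowCFTP C c S i Φ Coal`: `Φ` is an EXACT, vertically covariant row-resampling dynamics of
the middle data of the exchanged model `νmix (S ∆ {i,i+1})` given the pinned statistic, `Coal y m` are
sound certified-coalescence events of its grand coupling with exponential tails `C e^{-cm}` under
`νmix S ⊗ β`, and the depth-`r` sweeps are `2r`-local off probability `C e^{-cr}`. A statement the line
POSITS (the dynamical form of strong spatial mixing in mean of the diagram-conditioned chain). [folklore] -/
structure IsRowCFTP (C c : ℝ) (S : Set ℤ) (i : ℤ) (Φ : ℤ → Obs × Set (Site 2 × Site 2) → Rnd → Obs → Obs)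
    (Coal : ℤ → ℕ → Set ((Obs × Set (Site 2 × Site 2)) × Rnd)) : Prop where
  /-- the row maps are jointly measurable in (environment, bits, start) -/
  measurable : ∀ y, Measurable fun t : (Obs × Set (Site 2 × Site 2)) × (Rnd × Obs) => Φ y t.1 t.2.1 t.2.2
  /-- the row map at `y` rewrites only the middle data of row `y` -/
  writes_row : ∀ y p u z, (∀ w : Site 2, w ≠ ![i + 1, y] → (w ∈ (Φ y p u z).1 ↔ w ∈ z.1)) ∧
    (∀ f : Site 2, f ≠ ![i, y] → f ≠ ![i + 1, y] → (f ∈ (Φ y p u z).2 ↔ f ∈ z.2))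
  /-- vertical covariance of the row maps -/
  cov : ∀ (y k : ℤ) (x : Obs) (u : Rnd) (z : Obs),
    Φ y (pinnedStat i (vshift k x)) (ushift k u) (vshift k z) = vshift k (Φ (y - k) (pinnedStat i x) u z)
  /-- EXACTNESS: a sweep of the rows `a … a+n-1` from `X' ∼ νmix (S ∆ {i,i+1})`, in its own environment
  with fresh bits, has the law of `X'` jointly with the statistic on events not reading rows `≥ a+n` -/
  exact : ∀ (n : ℕ) (a : ℤ) (D : Set ((Obs × Set (Site 2 × Site 2)) × Obs)), MeasurableSet D →
    (∀ (p : Obs × Set (Site 2 × Site 2)) (z z' : Obs), (∀ w : Site 2, w 1 < a + n →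
      (w ∈ z.1 ↔ w ∈ z'.1) ∧ (w ∈ z.2 ↔ w ∈ z'.2)) → ((p, z) ∈ D ↔ (p, z') ∈ D)) →
    ((νmix (S ∆ {i, i + 1})).prod β) {xu | (pinnedStat i xu.1, rowSweep Φ n a (pinnedStat i xu.1) xu.2 xu.1) ∈ D} =
      (νmix (S ∆ {i, i + 1})) {x | (pinnedStat i x, x) ∈ D}
  /-- the certified-coalescence events are measurable -/
  coal_meas : ∀ y m, MeasurableSet (Coal y m)
  /-- SOUNDNESS: on `Coal y m` the sweep of the rows `y-m … y` gives the same row-`y` middle bits from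
  every start -/
  coal_sound : ∀ (y : ℤ) (m : ℕ) (p : Obs × Set (Site 2 × Site 2)) (u : Rnd), (p, u) ∈ Coal y m →
    ∀ z : Obs,
      (![i + 1, y] ∈ (rowSweep Φ (m + 1) (y - m) p u z).1 ↔ ![i + 1, y] ∈ (rowSweep Φ (m + 1) (y - m) p u p.1).1) ∧
      (![i, y] ∈ (rowSweep Φ (m + 1) (y - m) p u z).2 ↔ ![i, y] ∈ (rowSweep Φ (m + 1) (y - m) p u p.1).2) ∧
      (![i + 1, y] ∈ (rowSweep Φ (m + 1) (y - m) p u z).2 ↔ ![i + 1, y] ∈ (rowSweep Φ (m + 1) (y - m) p u p.1).2)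
  /-- exponential TAILS of the certified depth, under the input pattern `S` -/
  coal_tail : ∀ (y : ℤ) (m : ℕ), ((νmix S).prod β) {xu | (pinnedStat i xu.1, xu.2) ∉ Coal y m} ≤
    ENNReal.ofReal (C * Real.exp (-c * m))
  /-- vertical covariance of the certified-coalescence events -/
  coal_cov : ∀ (y : ℤ) (m : ℕ) (k : ℤ) (x : Obs) (u : Rnd),
    (pinnedStat i (vshift k x), ushift k u) ∈ Coal y m ↔ (pinnedStat i x, u) ∈ Coal (y - k) m
  /-- LOCAL APPROXIMATION: the depth-`r` sweeps started blank agree on the middle of `ballInf v r` with a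
  `2r`-local rule, off an event of probability `≤ C e^{-cr}` -/
  local_approx : ∀ (v : Site 2) (r : ℕ), ∃ Gfin : Obs → Rnd → Obs,
    (∀ (x x' : Obs) (u u' : Rnd),
      (∀ w ∈ ballInf v (2 * r), (w ∈ x.1 ↔ w ∈ x'.1) ∧ (w ∈ x.2 ↔ w ∈ x'.2) ∧
        ∀ k : ℕ, ((w, k) ∈ u ↔ (w, k) ∈ u')) →
      ∀ w ∈ ballInf v r, (w ∈ (Gfin x u).1 ↔ w ∈ (Gfin x' u').1) ∧ (w ∈ (Gfin x u).2 ↔ w ∈ (Gfin x' u').2)) ∧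
    ((νmix S).prod β) {xu | ∃ w ∈ ballInf v r,
      (w 0 = i + 1 ∧ ¬ (w ∈ (rowSweep Φ (r + 1) (w 1 - r) (pinnedStat i xu.1) xu.2 (eraseMid i xu.1)).1 ↔
        w ∈ (Gfin xu.1 xu.2).1)) ∨
      ((w 0 = i ∨ w 0 = i + 1) ∧ ¬ (w ∈ (rowSweep Φ (r + 1) (w 1 - r) (pinnedStat i xu.1) xu.2 (eraseMid i xu.1)).2 ↔
        w ∈ (Gfin xu.1 xu.2).2))} ≤ ENNReal.ofReal (C * Real.exp (-c * r))

/-- COMPOSITION (sorry-free; registered sub-goal): (A_dyn) with constants uniform in the admissible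
`(S, i)`, and the coding step (B) "`IsRowCFTP` + `StripDiagramExchange` ⇒ pinned sampler with constants
depending on the mixing constants only" (the content of `ps2_pinnedSampler_of_rowCFTP`), give the
registered signature of `stub_PinnedSampler` verbatim (identity sampler where `StripDiagramExchange`
fails). [folklore] -/
theorem pinnedSampler_of_rowCFTP :
    (∃ C c : ℝ, 0 < c ∧ ∀ (S : Set ℤ) (i : ℤ), (i ∈ S ↔ i + 1 ∉ S) → StripDiagramExchange S i →
      ∃ (Φ : ℤ → Obs × Set (Site 2 × Site 2) → Rnd → Obs → Obs)
        (Coal : ℤ → ℕ → Set ((Obs × Set (Site 2 × Site 2)) × Rnd)), IsRowCFTP C c S i Φ Coal) →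
    (∀ C c : ℝ, 0 < c → ∃ C' c' : ℝ, 0 < c' ∧ ∀ (S : Set ℤ) (i : ℤ)
      (Φ : ℤ → Obs × Set (Site 2 × Site 2) → Rnd → Obs → Obs)
      (Coal : ℤ → ℕ → Set ((Obs × Set (Site 2 × Site 2)) × Rnd)),
      IsRowCFTP C c S i Φ Coal → StripDiagramExchange S i → ∃ G : Obs → Rnd → Obs, PinnedSampler C' c' S i G) →
    ∃ C c : ℝ, 0 < c ∧ ∀ (S : Set ℤ) (i : ℤ), (i ∈ S ↔ i + 1 ∉ S) →
      ∃ G : Obs → Rnd → Obs, PinnedSampler C c S i G := by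
  rintro ⟨C, c, hc, hA⟩ hB
  obtain ⟨C', c', hc', hcod⟩ := hB C c hc
  refine ⟨C', c', hc', fun S i hSi => ?_⟩
  by_cases hX : StripDiagramExchange S i
  · obtain ⟨Φ, Coal, h⟩ := hA S i hSi hX
    exact hcod S i Φ Coal h hX
  · exact ⟨fun x _ => x, pinnedSampler_id_of_not C' c' S i hX⟩

end Summit.CriticalPhenomena.CardyFormulaZ2.Theorems.IKLinearTransport.PinnedDiagramExchange
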